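import Mathlib
import HarnessLib.Audit
import Summits.PneNP.PneNP.Theorems.PstarChordBridgeTools
import Summits.PneNP.PneNP.Theorems.PstarGSat
import Summits.PneNP.PneNP.Theorems.PstarGSystemFreeVar

/-!
# Joins of the XOR reads exist: flips of closed vertex sets, R6 at instance level, and `T`-joins by duality (ROUND-24, memo §1 / §9 R6 / §11.1)

FRONTIER range-avoidance ladder, rung F-N3, ROUND 24 (cell `pnp-ideate`, planner memo `r24/CORE-BOUND-NOTES.md` §1 ("`w_i` matters only if `U_i`
meets every component of `H` evenly … then for any `U_i`-join `T_i ⊆ H`"), §9 R6 (no free lunch), §11.1 ("U := the chosen vertices, made even per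
component"); restricted-model proof complexity — nothing here bears on `P` versus `NP`).

`PstarChordBridge.BridgeData` wants, for each constraint `(Cᵢ, Gᵢ, bᵢ)`, a JOIN `Tᵢ ⊆ F` of its XOR reads: the odd vertices of `Tᵢ` are exactly the
XOR vertices of `F` lying in `Cᵢ`.  This file proves that joins EXIST for terminal cores, path-free:

* `flipSet U z` — flip the variables of `U`; `eval_flipSet_iff` (pure typed: an output is preserved iff its XOR pair meets `U` evenly),
  `gval_flipSet` (a G-constraint moves by the parity of `#(C ∩ U)` when `U` avoids AND slots);
* `closed_even` — **R6 at instance level**: for a terminal core `J₀ ≠ ∅` (`#J₀ ≤ r`, (T3) unsolvable with two G-constraints whose monomials avoid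
  `J₀`, (M0) solvable after deleting any output) on a pure typed expanding instance with simple overlaps, every set `U` of XOR-slot variables
  CLOSED under `J₀` (each output of `J₀` has both or neither XOR variable in `U`) meets BOTH `C₁` and `C₂` evenly — otherwise flipping `U` and the
  `h = 1` theorem `PstarGSat.gSat` (or plain feasibility `PstarGapPeeling.feasible_of_boundaryExpanding` when the constraint is constant) solve the
  unsolvable system;
* `exists_join` — **joins by duality**: if every `F`-closed `U ⊆ xverts F` meets `C` evenly then a join `T ⊆ F` exists (the finite Fredholm alternative
  `PstarXorElimination.exists_solution_iff` for the vertex–output incidence system);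
* `exists_join_of_terminal` — hence joins `T₁, T₂ ⊆ F` exist for any `F ⊆ J₀` whose closed vertex sets are closed for `J₀` (e.g. `F = J₀ ∖ N` with
  every chord's ends joined inside `F`, `PstarChordBridgeNor.ends_connected_of_even`).
-/

set_option linter.dupNamespace false -- `Summit.PneNP.PneNP.…`: summit = sub-problem name (D-0017 single-conjunct layout)

open Finset Literature.Computability.Complexity
open scoped symmDiff
open Summit.PneNP.PneNP.Theorems.PstarFibrePolys (bit bit_xor bit_and bit_injective)
open Summit.PneNP.PneNP.Theorems.PstarPDT (parity bit_eval)
open Summit.PneNP.PneNP.Theorems.PstarTyped (Typed)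
open Summit.PneNP.PneNP.Theorems.PstarSALevel (varSet bdry BoundaryExpanding SimpleOverlap)
open Summit.PneNP.PneNP.Theorems.PstarGapOneAll (gval)
open Summit.PneNP.PneNP.Theorems.PstarGConstraint (bit_gval)
open Summit.PneNP.PneNP.Theorems.PstarGraphQuadGapOne (bit_parity)
open Summit.PneNP.PneNP.Theorems.PstarXorElimination (pdeg exists_solution_iff)
open Summit.PneNP.PneNP.Theorems.PstarXCore (xpair xverts mem_xpair)
open Summit.PneNP.PneNP.Theorems.PstarGapPeeling (feasible_of_boundaryExpanding)
open Summit.PneNP.PneNP.Theorems.PstarGSat (gSat)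
open Summit.PneNP.PneNP.Theorems.PstarGSystemFreeVar (gval_symmDiff)
open Summit.PneNP.PneNP.Theorems.PstarChordBridgeTools

namespace Summit.PneNP.PneNP.Theorems.PstarChordBridgeJoin

variable {n m : ℕ}

/-! ## Flipping a set of variables -/

/-- Flip the variables of `U`. -/
def flipSet (U : Finset (Fin n)) (z : Fin n → Bool) : Fin n → Bool := fun v => if v ∈ U then !z v else z v

/-- In `𝔽₂`: flipping adds the indicator of `U`. -/
theorem bit_flipSet (U : Finset (Fin n)) (z : Fin n → Bool) (v : Fin n) :
    bit (flipSet U z v) = bit (z v) + if v ∈ U then 1 else 0 := by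
  unfold flipSet
  by_cases h : v ∈ U
  · rw [if_pos h, if_pos h]; cases z v <;> decide
  · rw [if_neg h, if_neg h, add_zero]

/-- **An output survives the flip iff its XOR pair meets `U` evenly** (pure typed instance; `U` avoids AND slots). -/
theorem eval_flipSet_iff (I : LocalMap 4 n m) (hI : I.IsPure xorAndPred) {U : Finset (Fin n)}
    (hU : ∀ (j : Fin m) (s : Fin 4), 2 ≤ s.val → I.vars j s ∉ U) (z : Fin n → Bool) (j : Fin m) :
    I.eval (flipSet U z) j = I.eval z j ↔ (I.vars j 0 ∈ U ↔ I.vars j 1 ∈ U) := by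
  have h := bit_eval hI (flipSet U z) j
  rw [bit_flipSet, bit_flipSet, bit_flipSet, bit_flipSet, if_neg (hU j 2 (by decide)), if_neg (hU j 3 (by decide)), add_zero, add_zero,
    ← sub_eq_zero] at h
  have h0 := bit_eval hI z j
  constructor
  · intro he
    rw [he, h0] at h
    by_cases h₀ : I.vars j 0 ∈ U <;> by_cases h₁ : I.vars j 1 ∈ U <;> simp only [h₀, h₁, if_true, if_false] at h ⊢
    · revert h; generalize bit (z (I.vars j 0)) = a; generalize bit (z (I.vars j 1)) = b
      generalize bit (z (I.vars j 2)) * bit (z (I.vars j 3)) = c; revert a b c; decide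
    · revert h; generalize bit (z (I.vars j 0)) = a; generalize bit (z (I.vars j 1)) = b
      generalize bit (z (I.vars j 2)) * bit (z (I.vars j 3)) = c; revert a b c; decide
  · intro hiff
    apply bit_injective
    rw [h0]
    rw [sub_eq_zero] at h
    rw [h]
    by_cases h₀ : I.vars j 0 ∈ U
    · rw [if_pos h₀, if_pos (hiff.1 h₀)]; ring_nf; generalize bit (z (I.vars j 0)) = a; generalize bit (z (I.vars j 1)) = b
      generalize bit (z (I.vars j 2)) * bit (z (I.vars j 3)) = c; revert a b c; decide
    · rw [if_neg h₀, if_neg (fun h1 => h₀ (hiff.2 h1)), add_zero, add_zero]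

/-- **A G-constraint moves by the parity of `#(C ∩ U)`** when `U` avoids the AND slots of its monomials. -/
theorem bit_gval_flipSet (I : LocalMap 4 n m) {U : Finset (Fin n)} (C : Finset (Fin n)) {G : Finset (Fin m)}
    (hU : ∀ g ∈ G, I.vars g 2 ∉ U ∧ I.vars g 3 ∉ U) (z : Fin n → Bool) :
    bit (gval I C G (flipSet U z)) = bit (gval I C G z) + ((C.filter fun v => v ∈ U).card : ZMod 2) := by
  classical
  rw [bit_gval, bit_gval]
  have hG : ∑ g ∈ G, bit (flipSet U z (I.vars g 2)) * bit (flipSet U z (I.vars g 3)) =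
      ∑ g ∈ G, bit (z (I.vars g 2)) * bit (z (I.vars g 3)) :=
    sum_congr rfl fun g hg => by rw [bit_flipSet, bit_flipSet, if_neg (hU g hg).1, if_neg (hU g hg).2, add_zero, add_zero]
  have hC : ∑ v ∈ C, bit (flipSet U z v) = ∑ v ∈ C, bit (z v) + ((C.filter fun v => v ∈ U).card : ZMod 2) := by
    simp only [bit_flipSet, sum_add_distrib]
    rw [card_filter, Nat.cast_sum]
    congr 1
    exact sum_congr rfl fun v _ => by split_ifs <;> simp
  rw [hG, hC]
  ring

/-- Boolean form: the constraint is preserved iff `#(C ∩ U)` is even. -/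
theorem gval_flipSet_iff (I : LocalMap 4 n m) {U : Finset (Fin n)} (C : Finset (Fin n)) {G : Finset (Fin m)}
    (hU : ∀ g ∈ G, I.vars g 2 ∉ U ∧ I.vars g 3 ∉ U) (z : Fin n → Bool) :
    gval I C G (flipSet U z) = gval I C G z ↔ Even (C.filter fun v => v ∈ U).card := by
  have h := bit_gval_flipSet I C hU z
  constructor
  · intro he
    rw [he] at h
    have : ((C.filter fun v => v ∈ U).card : ZMod 2) = 0 := by
      have e : ∀ a c : ZMod 2, a = a + c → c = 0 := by decide
      exact e _ _ h
    exact (ZMod.natCast_eq_zero_iff_even).1 this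
  · intro hev
    apply bit_injective
    rw [h, (ZMod.natCast_eq_zero_iff_even).2 hev, add_zero]

/-! ## R6 at instance level: closed vertex sets meet both constraints evenly -/

/-- **A G-constraint that fails on every solution of `J₀` fails on any single assignment** (`h = 1`): if it were non-constant, `PstarGSat.gSat` would
satisfy it together with `J₀`; if constant, `J₀` alone is feasible (`feasible_of_boundaryExpanding`). -/
theorem false_of_unsat (I : LocalMap 4 n m) (hI : I.IsPure xorAndPred) (hT : Typed I) (hS : SimpleOverlap I) {r : ℕ}
    (hB : BoundaryExpanding r I) (y : Fin m → Bool) {J₀ : Finset (Fin m)} (hr : J₀.card ≤ r) {C : Finset (Fin n)} {G : Finset (Fin m)}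
    (hG : Disjoint J₀ G) {b : Bool} (hun : ∀ z, (∀ j ∈ J₀, I.eval z j = y j) → gval I C G z ≠ b) {z₀ : Fin n → Bool}
    (hz₀ : gval I C G z₀ = b) : False := by
  by_cases hnc : ∃ z z' : Fin n → Bool, gval I C G z ≠ gval I C G z'
  · obtain ⟨z, hz, hb⟩ := gSat n m r I hI hT hB hS y J₀ G C b hr hG hnc
    exact hun z hz hb
  · push Not at hnc
    obtain ⟨z, hz⟩ := feasible_of_boundaryExpanding I hI hB y J₀ hr
    exact hun z hz ((hnc z z₀).trans hz₀)

/-- **R6 — closed vertex sets are even for both constraints.**  Terminal core `J₀ ≠ ∅` with `#J₀ ≤ r`, two G-constraints with monomials disjoint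
from `J₀`, (T3) and (M0); `U` a set of variables avoiding all AND slots and CLOSED under `J₀`.  Then `#(C₁ ∩ U)` and `#(C₂ ∩ U)` are even. -/
theorem closed_even (I : LocalMap 4 n m) (hI : I.IsPure xorAndPred) (hT : Typed I) (hS : SimpleOverlap I) {r : ℕ} (hB : BoundaryExpanding r I)
    (y : Fin m → Bool) {J₀ : Finset (Fin m)} (hne : J₀.Nonempty) (hr : J₀.card ≤ r)
    {C₁ C₂ : Finset (Fin n)} {G₁ G₂ : Finset (Fin m)} {b₁ b₂ : Bool} (hG₁ : Disjoint J₀ G₁) (hG₂ : Disjoint J₀ G₂)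
    (hT3 : ¬ ∃ z : Fin n → Bool, (∀ j ∈ J₀, I.eval z j = y j) ∧ gval I C₁ G₁ z = b₁ ∧ gval I C₂ G₂ z = b₂)
    (hM0 : ∀ f ∈ J₀, ∃ z : Fin n → Bool, (∀ j ∈ J₀.erase f, I.eval z j = y j) ∧ gval I C₁ G₁ z = b₁ ∧ gval I C₂ G₂ z = b₂)
    {U : Finset (Fin n)} (hU : ∀ (j : Fin m) (s : Fin 4), 2 ≤ s.val → I.vars j s ∉ U)
    (hclosed : ∀ j ∈ J₀, (I.vars j 0 ∈ U ↔ I.vars j 1 ∈ U)) :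
    Even (C₁.filter fun v => v ∈ U).card ∧ Even (C₂.filter fun v => v ∈ U).card := by
  classical
  obtain ⟨f, hf⟩ := hne
  obtain ⟨z₀, -, hz₁, hz₂⟩ := hM0 f hf
  have hUG : ∀ G : Finset (Fin m), ∀ g ∈ G, I.vars g 2 ∉ U ∧ I.vars g 3 ∉ U := fun G g _ => ⟨hU g 2 (by decide), hU g 3 (by decide)⟩
  have hflipJ : ∀ z : Fin n → Bool, (∀ j ∈ J₀, I.eval z j = y j) → ∀ j ∈ J₀, I.eval (flipSet U z) j = y j :=
    fun z hz j hj => by rw [(eval_flipSet_iff I hI hU z j).2 (hclosed j hj)]; exact hz j hj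
  have bflip : ∀ a b c : Bool, a ≠ b → c ≠ a → c = b := by decide
  -- the effect of the flip on each constraint
  have hkeep : ∀ (C : Finset (Fin n)) (G : Finset (Fin m)) (z : Fin n → Bool), Even (C.filter fun v => v ∈ U).card →
      gval I C G (flipSet U z) = gval I C G z := fun C G z h => (gval_flipSet_iff I C (hUG G) z).2 h
  have hmove : ∀ (C : Finset (Fin n)) (G : Finset (Fin m)) (z : Fin n → Bool), ¬ Even (C.filter fun v => v ∈ U).card →
      gval I C G (flipSet U z) ≠ gval I C G z := fun C G z h he => h ((gval_flipSet_iff I C (hUG G) z).1 he)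
  by_contra hnot
  by_cases h₁ : Even (C₁.filter fun v => v ∈ U).card <;> by_cases h₂ : Even (C₂.filter fun v => v ∈ U).card
  · exact hnot ⟨h₁, h₂⟩
  · -- `Γ₁` is kept, `Γ₂` moves: `J₀ ∧ Γ₁` is unsolvable
    refine false_of_unsat I hI hT hS hB y hr hG₁ (fun z hz hb₁ => ?_) hz₁
    by_cases hb₂ : gval I C₂ G₂ z = b₂
    · exact hT3 ⟨z, hz, hb₁, hb₂⟩
    · exact hT3 ⟨flipSet U z, hflipJ z hz, by rw [hkeep C₁ G₁ z h₁, hb₁], bflip _ _ _ hb₂ (hmove C₂ G₂ z h₂)⟩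
  · -- symmetric
    refine false_of_unsat I hI hT hS hB y hr hG₂ (fun z hz hb₂ => ?_) hz₂
    by_cases hb₁ : gval I C₁ G₁ z = b₁
    · exact hT3 ⟨z, hz, hb₁, hb₂⟩
    · exact hT3 ⟨flipSet U z, hflipJ z hz, bflip _ _ _ hb₁ (hmove C₁ G₁ z h₁), by rw [hkeep C₂ G₂ z h₂, hb₂]⟩
  · -- both move: `J₀ ∧ (Γ₁ + Γ₂)` is unsolvable
    have hG : Disjoint J₀ (G₁ ∆ G₂) := by
      rw [disjoint_left]
      intro g hg hg'
      rw [mem_symmDiff] at hg'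
      rcases hg' with ⟨h, -⟩ | ⟨h, -⟩
      · exact disjoint_left.1 hG₁ hg h
      · exact disjoint_left.1 hG₂ hg h
    refine false_of_unsat I hI hT hS hB y hr hG (C := C₁ ∆ C₂) (b := xor b₁ b₂) (fun z hz hb => ?_)
      (by rw [gval_symmDiff, hz₁, hz₂])
    rw [gval_symmDiff] at hb
    by_cases hb₁ : gval I C₁ G₁ z = b₁
    · rw [hb₁] at hb
      have hb₂ : gval I C₂ G₂ z = b₂ := by revert hb; cases b₁ <;> cases b₂ <;> cases gval I C₂ G₂ z <;> decide
      exact hT3 ⟨z, hz, hb₁, hb₂⟩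
    · have hb₂ : gval I C₂ G₂ z ≠ b₂ := by
        intro hb₂; rw [hb₂] at hb; apply hb₁; revert hb; cases b₁ <;> cases b₂ <;> cases gval I C₁ G₁ z <;> decide
      exact hT3 ⟨flipSet U z, hflipJ z hz, bflip _ _ _ hb₁ (hmove C₁ G₁ z h₁), bflip _ _ _ hb₂ (hmove C₂ G₂ z h₂)⟩

/-! ## Joins by duality -/

/-- The incidence functional of vertex `w` on the outputs of `F`: `t ↦ Σ_{j ∈ F} ([u_j = w] + [v_j = w])·t_j`. -/
def incidence (I : LocalMap 4 n m) (F : Finset (Fin m)) (w : Fin n) : (Fin m → ZMod 2) →ₗ[ZMod 2] ZMod 2 :=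
  ∑ j ∈ F, ((if I.vars j 0 = w then (1 : ZMod 2) else 0) + (if I.vars j 1 = w then 1 else 0)) • LinearMap.proj j

/-- Evaluation of the incidence functional. -/
theorem incidence_apply (I : LocalMap 4 n m) (F : Finset (Fin m)) (w : Fin n) (t : Fin m → ZMod 2) :
    incidence I F w t = ∑ j ∈ F, ((if I.vars j 0 = w then (1 : ZMod 2) else 0) + (if I.vars j 1 = w then 1 else 0)) * t j := by
  unfold incidence
  rw [LinearMap.coe_sum, Finset.sum_apply]
  exact sum_congr rfl fun j _ => by simp [smul_eq_mul]

/-- **Joins exist by duality.**  If every set `U ⊆ xverts F` closed under `F` meets `C` evenly, then some `T ⊆ F` has as odd vertices exactly the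
XOR vertices of `F` lying in `C`. -/
theorem exists_join (I : LocalMap 4 n m) (F : Finset (Fin m)) (C : Finset (Fin n))
    (h : ∀ U ⊆ xverts I F, (∀ j ∈ F, (I.vars j 0 ∈ U ↔ I.vars j 1 ∈ U)) → Even (C.filter fun v => v ∈ U).card) :
    ∃ T ⊆ F, ∀ w, Odd (xpdeg I T w) ↔ (w ∈ C ∧ w ∈ xverts I F) := by
  classical
  -- solve the incidence system `incidence w · t = [w ∈ C]` for `w ∈ xverts F`
  have hsol := (exists_solution_iff (incidence I F) (fun w => if w ∈ C then (1 : ZMod 2) else 0) (xverts I F)).2 (by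
    intro D hD hdep
    -- a dependency is a closed set
    have hclosed : ∀ j ∈ F, (I.vars j 0 ∈ D ↔ I.vars j 1 ∈ D) := by
      intro j hj
      have e := congrArg (fun L : (Fin m → ZMod 2) →ₗ[ZMod 2] ZMod 2 => L (Pi.single j 1)) hdep
      simp only [LinearMap.coe_sum, Finset.sum_apply, LinearMap.zero_apply, incidence_apply] at e
      have hsingle : ∀ w, ∑ j' ∈ F, ((if I.vars j' 0 = w then (1 : ZMod 2) else 0) + (if I.vars j' 1 = w then 1 else 0)) *
          (Pi.single j (1 : ZMod 2) : Fin m → ZMod 2) j' =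
          (if I.vars j 0 = w then (1 : ZMod 2) else 0) + (if I.vars j 1 = w then 1 else 0) := by
        intro w
        rw [sum_eq_single j]
        · rw [Pi.single_eq_same, mul_one]
        · intro j' _ hj'; rw [Pi.single_eq_of_ne hj', mul_zero]
        · intro hj'; exact absurd hj hj'
      simp only [hsingle] at e
      rw [sum_add_distrib, sum_ite_eq, sum_ite_eq] at e
      have h01 : ∀ a b : Prop, ∀ [Decidable a] [Decidable b],
          ((if a then (1 : ZMod 2) else 0) + (if b then 1 else 0) = 0) → (a ↔ b) := by
        intro a b _ _ hab
        by_cases ha : a <;> by_cases hb : b <;> simp_all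
      exact h01 _ _ e
    have hev := h D hD hclosed
    rw [← sum_filter, sum_const, nsmul_eq_mul, mul_one]
    have : (D.filter fun w => w ∈ C) = (C.filter fun v => v ∈ D) := by
      ext v; simp only [mem_filter]; tauto
    rw [this]
    exact (ZMod.natCast_eq_zero_iff_even).2 hev)
  obtain ⟨t, ht⟩ := hsol
  refine ⟨F.filter fun j => t j = 1, filter_subset _ _, fun w => ?_⟩
  -- parity of the slot-degree of `T` at `w` is the incidence value
  have hpar : (xpdeg I (F.filter fun j => t j = 1) w : ZMod 2) = incidence I F w t := by
    rw [incidence_apply]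
    unfold xpdeg pdeg
    rw [filter_filter, filter_filter, Nat.cast_add, card_eq_sum_ones, card_eq_sum_ones, Nat.cast_sum, Nat.cast_sum, sum_filter, sum_filter,
      ← sum_add_distrib]
    refine sum_congr rfl fun j _ => ?_
    have ht01 : t j = 0 ∨ t j = 1 := by generalize t j = a; revert a; decide
    rcases ht01 with h0 | h1
    · simp [h0]
    · simp [h1]
  by_cases hw : w ∈ xverts I F
  · have hv := ht w hw
    rw [← hpar] at hv
    constructor
    · intro hodd
      refine ⟨?_, hw⟩
      by_contra hwC
      rw [if_neg hwC] at hv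
      exact (Nat.not_even_iff_odd.2 hodd) ((ZMod.natCast_eq_zero_iff_even).1 hv)
    · rintro ⟨hwC, -⟩
      rw [if_pos hwC] at hv
      exact (ZMod.natCast_eq_one_iff_odd).1 hv
  · -- outside the vertices of `F` the degree is `0`
    have h0 : xpdeg I (F.filter fun j => t j = 1) w = 0 := by
      unfold xpdeg pdeg
      rw [card_eq_zero.2, card_eq_zero.2]
      · refine filter_eq_empty_iff.2 fun j hj hj1 => hw ?_
        unfold PstarXCore.xverts; rw [mem_biUnion]
        exact ⟨j, (mem_filter.1 hj).1, (mem_xpair I).2 (Or.inr hj1.symm)⟩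
      · refine filter_eq_empty_iff.2 fun j hj hj0 => hw ?_
        unfold PstarXCore.xverts; rw [mem_biUnion]
        exact ⟨j, (mem_filter.1 hj).1, (mem_xpair I).2 (Or.inl hj0.symm)⟩
    rw [h0]
    constructor
    · intro hodd; exact absurd hodd (by decide)
    · rintro ⟨-, hw'⟩; exact absurd hw' hw

/-- Closure transfers along chains: a set closed under `F` contains both or neither end of a chain of outputs of `F`. -/
theorem closed_of_chain (I : LocalMap 4 n m) {F : Finset (Fin m)} {U : Finset (Fin n)} (hclosed : ∀ j ∈ F, (I.vars j 0 ∈ U ↔ I.vars j 1 ∈ U))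
    {x y : Fin n} (hr : Relation.ReflTransGen (fun x y => ∃ j ∈ F, x ∈ xpair I j ∧ y ∈ xpair I j) x y) : (x ∈ U ↔ y ∈ U) := by
  induction hr with
  | refl => exact Iff.rfl
  | tail _ hst ih =>
    obtain ⟨j, hj, hb, hc⟩ := hst
    have hj' := hclosed j hj
    have key : ∀ {v}, v ∈ xpair I j → (v ∈ U ↔ I.vars j 0 ∈ U) := fun {v} hv => by
      rcases (mem_xpair I).1 hv with rfl | rfl
      · exact Iff.rfl
      · exact hj'.symm
    exact ih.trans ((key hb).trans (key hc).symm)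

/-- **Joins exist for a terminal core.**  With the hypotheses of `closed_even`, let `F ⊆ J₀` be such that every output of `J₀` has its XOR ends
joined by a chain inside `F` (e.g. `F = J₀ ∖ N` and every chord has a fundamental set, `PstarChordBridgeNor.ends_connected_of_even`; outputs of
`F` itself are joined by themselves).  Then both constraints admit joins in `F`. -/
theorem exists_join_of_terminal (I : LocalMap 4 n m) (hI : I.IsPure xorAndPred) (hT : Typed I) (hS : SimpleOverlap I) {r : ℕ}
    (hB : BoundaryExpanding r I) (y : Fin m → Bool) {J₀ : Finset (Fin m)} (hne : J₀.Nonempty) (hr : J₀.card ≤ r)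
    {C₁ C₂ : Finset (Fin n)} {G₁ G₂ : Finset (Fin m)} {b₁ b₂ : Bool} (hG₁ : Disjoint J₀ G₁) (hG₂ : Disjoint J₀ G₂)
    (hT3 : ¬ ∃ z : Fin n → Bool, (∀ j ∈ J₀, I.eval z j = y j) ∧ gval I C₁ G₁ z = b₁ ∧ gval I C₂ G₂ z = b₂)
    (hM0 : ∀ f ∈ J₀, ∃ z : Fin n → Bool, (∀ j ∈ J₀.erase f, I.eval z j = y j) ∧ gval I C₁ G₁ z = b₁ ∧ gval I C₂ G₂ z = b₂)
    {F : Finset (Fin m)}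
    (hconn : ∀ e ∈ J₀, Relation.ReflTransGen (fun x y => ∃ j ∈ F, x ∈ xpair I j ∧ y ∈ xpair I j) (I.vars e 0) (I.vars e 1)) :
    (∃ T₁ ⊆ F, ∀ w, Odd (xpdeg I T₁ w) ↔ (w ∈ C₁ ∧ w ∈ xverts I F)) ∧
    (∃ T₂ ⊆ F, ∀ w, Odd (xpdeg I T₂ w) ↔ (w ∈ C₂ ∧ w ∈ xverts I F)) := by
  have key : ∀ U ⊆ xverts I F, (∀ j ∈ F, (I.vars j 0 ∈ U ↔ I.vars j 1 ∈ U)) →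
      Even (C₁.filter fun v => v ∈ U).card ∧ Even (C₂.filter fun v => v ∈ U).card := by
    intro U hU hclF
    have hUand : ∀ (j : Fin m) (s : Fin 4), 2 ≤ s.val → I.vars j s ∉ U := fun j s hs h => not_mem_xverts_of_two_le I hT F j hs (hU h)
    exact closed_even I hI hT hS hB y hne hr hG₁ hG₂ hT3 hM0 hUand fun j hj => closed_of_chain I hclF (hconn j hj)
  exact ⟨exists_join I F C₁ fun U hU hcl => (key U hU hcl).1, exists_join I F C₂ fun U hU hcl => (key U hU hcl).2⟩

end Summit.PneNP.PneNP.Theorems.PstarChordBridgeJoin
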